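import Literature.MathematicalPhysics.QuantumManyBody.JelliumLemma53
import HarnessLib

/-!
# `n̂₀ + n̂₊ = n` and `n̂₀(n̂₀-1) = n(n-1) - (2n-1)n̂₊ + n̂₊²` in expectation (first quantization)

Topic `Literature/MathematicalPhysics/QuantumManyBody` (the charged Bose gas, `JelliumBoseGas.foldyLaw`).
The operator algebra used throughout [LiebSolovej2001, §5–§8] — "on the subspace where the total
particle number is `n`, `n̂₊ = n - n̂₀`" and the second equality of [LiebSolovej2001, Lemma 5.2],
`½ŵ_{00,00}[(n̂₀-ρℓ³)² - n̂₀] = ½ŵ_{00,00}[(n-ρℓ³)² + n̂₊² - 2(n-ρℓ³)n̂₊ - n̂₀]` — in the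
first-quantized expectation form of the tree (`Pⱼ`, `Qⱼ` of `JelliumSliceProjections.lean`,
`⟨n̂₀⟩ = ∑ⱼ‖PⱼΨ‖²`, `⟨n̂₊⟩ = ∑ⱼ‖QⱼΨ‖²`, `⟨n̂₀(n̂₀-1)⟩ = ∑_{i≠j}‖PᵢPⱼΨ‖²`,
`⟨n̂₊²⟩ = ∑ⱼ‖QⱼΨ‖² + ∑_{i≠j}‖QⱼQᵢΨ‖²`), all norms in `L²(Λⁿ)`, `Λⁿ = cellN`:

* `lintegral_cellN_normSq_eq_add` — Pythagoras `‖F‖² = ‖QⱼF‖² + ‖PⱼF‖²` for continuous `F`;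
* `sum_normSq_P_add_sum_normSq_Q` — **`⟨n̂₀⟩ + ⟨n̂₊⟩ = n‖Ψ‖²`**;
* `sliceMean_sliceFluct_self`, `sliceFluct_sliceFluct_self` — `PⱼQⱼ = 0`, `QⱼQⱼ = Qⱼ`;
* `depletion_eq_sum_normSq_Q` — the tree's `depletion n ℓ Ψ` is `⟨n̂₊⟩`;
* `sum_PP_add_sum_QP`, `sum_PQ_add_sum_QQ`, `normSq_QP_eq_normSq_PQ` — the additive identities
  `∑_{i≠j}‖PᵢPⱼΨ‖² + ∑_{i≠j}‖QᵢPⱼΨ‖² = (n-1)⟨n̂₀⟩`, `∑_{i≠j}‖PⱼQᵢΨ‖² + ∑_{i≠j}‖QⱼQᵢΨ‖² = (n-1)⟨n̂₊⟩`,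
  `‖QᵢPⱼΨ‖ = ‖PⱼQᵢΨ‖`;
* `n0n0_identity` — **`⟨n̂₀(n̂₀-1)⟩ = n(n-1)‖Ψ‖² - (2n-1)⟨n̂₊⟩ + ⟨n̂₊²⟩`** (real form).

## References

* [LiebSolovej2001] E. H. Lieb, J. P. Solovej, Commun. Math. Phys. 217 (2001) 127–163, §5 (before
  Lemma 5.1) and Lemma 5.2 (arXiv:cond-mat/0007425, p. 11).
-/

noncomputable section

open MeasureTheory Set Filter Real
open scoped ENNReal NNReal Topology

namespace Literature.MathematicalPhysics.QuantumManyBody.JelliumBoseGas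

open BoseGas
open Literature.Barriers.AtomisticToContinuum.BoseGas (depletion measurable_lintegral_cell_update)

variable {n : ℕ} {ℓ : ℝ}

/-! ### Pythagoras in `L²(Λⁿ)` -/

/-- **Pythagoras `‖F‖² = ‖QⱼF‖² + ‖PⱼF‖²` in `L²(Λⁿ)`** for continuous `F` (`ℓ > 0`).
[cite: LiebSolovej2001, §5] -/
theorem lintegral_cellN_normSq_eq_add (hℓ : 0 < ℓ) (j : Fin n) {F : Config n → ℂ} (hF : Continuous F) :
    ∫⁻ X in cellN n ℓ, (‖F X‖₊ : ℝ≥0∞) ^ 2 =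
      (∫⁻ X in cellN n ℓ, (‖sliceFluct ℓ j F X‖₊ : ℝ≥0∞) ^ 2) +
        ∫⁻ X in cellN n ℓ, (‖sliceMean ℓ j F X‖₊ : ℝ≥0∞) ^ 2 := by
  have hL3 : ENNReal.ofReal ℓ ^ 3 ≠ 0 := pow_ne_zero _ (by simpa using hℓ)
  have hL3' : ENNReal.ofReal ℓ ^ 3 ≠ ⊤ := ENNReal.pow_ne_top ENNReal.ofReal_ne_top
  have hPm : Measurable (sliceMean ℓ j F) := (continuous_sliceMean ℓ j hF).measurable
  have hQm : Measurable (sliceFluct ℓ j F) := (continuous_sliceFluct ℓ j hF).measurable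
  have hH : Measurable fun X : Config n => (‖F X‖₊ : ℝ≥0∞) ^ 2 :=
    hF.measurable.nnnorm.coe_nnreal_ennreal.pow_const _
  have hHQ : Measurable fun X : Config n => (‖sliceFluct ℓ j F X‖₊ : ℝ≥0∞) ^ 2 :=
    hQm.nnnorm.coe_nnreal_ennreal.pow_const _
  have hHP : Measurable fun X : Config n => (‖sliceMean ℓ j F X‖₊ : ℝ≥0∞) ^ 2 :=
    hPm.nnnorm.coe_nnreal_ennreal.pow_const _
  have e1 := lintegral_cellN_lintegral_update j hH (L := ℓ)
  have e2 := lintegral_cellN_lintegral_update j hHQ (L := ℓ)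
  have e3 := lintegral_cellN_lintegral_update j hHP (L := ℓ)
  obtain ⟨C, hC⟩ := exists_bound_update_of_continuous hF ℓ j
  have hfib : ∀ X ∈ cellN n ℓ,
      ∫⁻ y in cell ℓ, (‖F (Function.update X j y)‖₊ : ℝ≥0∞) ^ 2 =
        (∫⁻ y in cell ℓ, (‖sliceFluct ℓ j F (Function.update X j y)‖₊ : ℝ≥0∞) ^ 2) +
          ∫⁻ y in cell ℓ, (‖sliceMean ℓ j F (Function.update X j y)‖₊ : ℝ≥0∞) ^ 2 := by
    intro X hX
    simp_rw [sliceMean_update]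
    rw [setLIntegral_const, volume_cell,
      lintegral_cell_normSq_eq_of_bounded hℓ j hF.measurable X
        (fun y hy => hC X (cellN_subset_closedCubeN n ℓ hX) y hy), mul_comm]
  have hmeasQ : Measurable fun X : Config n => ∫⁻ y in cell ℓ,
      (‖sliceFluct ℓ j F (Function.update X j y)‖₊ : ℝ≥0∞) ^ 2 :=
    measurable_lintegral_cell_update ℓ j hHQ
  rw [← ENNReal.mul_right_inj hL3 hL3', mul_add, ← e1, ← e2, ← e3, ← lintegral_add_left hmeasQ]
  exact setLIntegral_congr_fun (measurableSet_cellN n ℓ) hfib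

/-- **`⟨n̂₀⟩ + ⟨n̂₊⟩ = n‖Ψ‖²`** (`∑ⱼPⱼ + ∑ⱼQⱼ = n`), for continuous `Ψ` and `ℓ > 0`.
[cite: LiebSolovej2001, §5] -/
theorem sum_normSq_P_add_sum_normSq_Q (hℓ : 0 < ℓ) {Ψ : Config n → ℂ} (hΨ : Continuous Ψ) :
    (∑ j : Fin n, ∫⁻ X in cellN n ℓ, (‖sliceMean ℓ j Ψ X‖₊ : ℝ≥0∞) ^ 2) +
        ∑ j : Fin n, ∫⁻ X in cellN n ℓ, (‖sliceFluct ℓ j Ψ X‖₊ : ℝ≥0∞) ^ 2 =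
      n * ∫⁻ X in cellN n ℓ, (‖Ψ X‖₊ : ℝ≥0∞) ^ 2 := by
  rw [← Finset.sum_add_distrib]
  have h : ∀ j : Fin n, (∫⁻ X in cellN n ℓ, (‖sliceMean ℓ j Ψ X‖₊ : ℝ≥0∞) ^ 2) +
      ∫⁻ X in cellN n ℓ, (‖sliceFluct ℓ j Ψ X‖₊ : ℝ≥0∞) ^ 2 = ∫⁻ X in cellN n ℓ, (‖Ψ X‖₊ : ℝ≥0∞) ^ 2 :=
    fun j => by rw [add_comm, ← lintegral_cellN_normSq_eq_add hℓ j hΨ]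
  simp only [h, Finset.sum_const, Finset.card_univ, Fintype.card_fin, nsmul_eq_mul]

/-! ### `PⱼQⱼ = 0`, `QⱼQⱼ = Qⱼ`, and the depletion -/

/-- **`Pⱼ(QⱼΨ) = 0`** for continuous `Ψ` (`ℓ > 0`). [cite: LiebSolovej2001, §5] -/
theorem sliceMean_sliceFluct_self (hℓ : 0 < ℓ) (j : Fin n) {Ψ : Config n → ℂ} (hΨ : Continuous Ψ)
    (X : Config n) : sliceMean ℓ j (sliceFluct ℓ j Ψ) X = 0 := by
  rw [sliceMean_sliceFluct_comm hℓ j j hΨ, sliceFluct, sliceMean_sliceMean hℓ, sub_self]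

/-- **`Qⱼ(QⱼΨ) = QⱼΨ`** for continuous `Ψ` (`ℓ > 0`). [cite: LiebSolovej2001, §5] -/
theorem sliceFluct_sliceFluct_self (hℓ : 0 < ℓ) (j : Fin n) {Ψ : Config n → ℂ} (hΨ : Continuous Ψ)
    (X : Config n) : sliceFluct ℓ j (sliceFluct ℓ j Ψ) X = sliceFluct ℓ j Ψ X := by
  rw [sliceFluct, sliceMean_sliceFluct_self hℓ j hΨ, sub_zero]

/-- **The tree's depletion functional is `⟨n̂₊⟩ = ∑ⱼ‖QⱼΨ‖²_{L²(Λⁿ)}`** for continuous `Ψ`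
(`ℓ > 0`). [cite: LiebSolovej2001, §5] -/
theorem depletion_eq_sum_normSq_Q (hℓ : 0 < ℓ) {Ψ : Config n → ℂ} (hΨ : Continuous Ψ) :
    depletion n ℓ Ψ = ∑ j : Fin n, ∫⁻ X in cellN n ℓ, (‖sliceFluct ℓ j Ψ X‖₊ : ℝ≥0∞) ^ 2 := by
  have hL3 : ENNReal.ofReal ℓ ^ 3 ≠ 0 := pow_ne_zero _ (by simpa using hℓ)
  have hL3' : ENNReal.ofReal ℓ ^ 3 ≠ ⊤ := ENNReal.pow_ne_top ENNReal.ofReal_ne_top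
  rw [depletion_eq_sum_sliceFluct]
  refine Finset.sum_congr rfl fun j _ => ?_
  have hHQ : Measurable fun X : Config n => (‖sliceFluct ℓ j Ψ X‖₊ : ℝ≥0∞) ^ 2 :=
    (continuous_sliceFluct ℓ j hΨ).measurable.nnnorm.coe_nnreal_ennreal.pow_const _
  rw [lintegral_cellN_lintegral_update j hHQ, ← mul_assoc, ENNReal.inv_mul_cancel hL3 hL3', one_mul]

/-! ### Second moments -/

/-- `‖Qᵢ(PⱼΨ)‖ = ‖Pⱼ(QᵢΨ)‖` pointwise (`PⱼQᵢ = QᵢPⱼ`). [cite: LiebSolovej2001, §5] -/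
theorem normSq_QP_eq_normSq_PQ (hℓ : 0 < ℓ) (i j : Fin n) {Ψ : Config n → ℂ} (hΨ : Continuous Ψ)
    (X : Config n) : ‖sliceFluct ℓ i (sliceMean ℓ j Ψ) X‖ = ‖sliceMean ℓ j (sliceFluct ℓ i Ψ) X‖ := by
  rw [sliceMean_sliceFluct_comm hℓ j i hΨ]

/-- **`∑_{i≠j}‖PᵢPⱼΨ‖² + ∑_{i≠j}‖QᵢPⱼΨ‖² = (n-1)⟨n̂₀⟩`** (Pythagoras in `i` applied to `PⱼΨ`).
[cite: LiebSolovej2001, Lemma 5.2] -/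
theorem sum_PP_add_sum_QP (hℓ : 0 < ℓ) {Ψ : Config n → ℂ} (hΨ : Continuous Ψ) :
    (∑ j : Fin n, ∑ i ∈ Finset.univ.erase j,
        ∫⁻ X in cellN n ℓ, (‖sliceMean ℓ i (sliceMean ℓ j Ψ) X‖₊ : ℝ≥0∞) ^ 2) +
      ∑ j : Fin n, ∑ i ∈ Finset.univ.erase j,
        ∫⁻ X in cellN n ℓ, (‖sliceFluct ℓ i (sliceMean ℓ j Ψ) X‖₊ : ℝ≥0∞) ^ 2 =
      ((n : ℝ≥0∞) - 1) * ∑ j : Fin n, ∫⁻ X in cellN n ℓ, (‖sliceMean ℓ j Ψ X‖₊ : ℝ≥0∞) ^ 2 := by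
  rw [← Finset.sum_add_distrib, Finset.mul_sum]
  refine Finset.sum_congr rfl fun j _ => ?_
  rw [← Finset.sum_add_distrib]
  have hF : Continuous (sliceMean ℓ j Ψ) := continuous_sliceMean ℓ j hΨ
  have h : ∀ i ∈ Finset.univ.erase j,
      (∫⁻ X in cellN n ℓ, (‖sliceMean ℓ i (sliceMean ℓ j Ψ) X‖₊ : ℝ≥0∞) ^ 2) +
        ∫⁻ X in cellN n ℓ, (‖sliceFluct ℓ i (sliceMean ℓ j Ψ) X‖₊ : ℝ≥0∞) ^ 2 =
      ∫⁻ X in cellN n ℓ, (‖sliceMean ℓ j Ψ X‖₊ : ℝ≥0∞) ^ 2 :=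
    fun i _ => by rw [add_comm, ← lintegral_cellN_normSq_eq_add hℓ i hF]
  rw [Finset.sum_congr rfl h, Finset.sum_const, Finset.card_erase_of_mem (Finset.mem_univ j),
    Finset.card_univ, Fintype.card_fin, nsmul_eq_mul, ENNReal.natCast_sub, Nat.cast_one]

/-- **`∑_{i≠j}‖PⱼQᵢΨ‖² + ∑_{i≠j}‖QⱼQᵢΨ‖² = (n-1)⟨n̂₊⟩`** (Pythagoras in `j` applied to `QᵢΨ`).
[cite: LiebSolovej2001, Lemma 5.2] -/
theorem sum_PQ_add_sum_QQ (hℓ : 0 < ℓ) {Ψ : Config n → ℂ} (hΨ : Continuous Ψ) :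
    (∑ i : Fin n, ∑ j ∈ Finset.univ.erase i,
        ∫⁻ X in cellN n ℓ, (‖sliceMean ℓ j (sliceFluct ℓ i Ψ) X‖₊ : ℝ≥0∞) ^ 2) +
      ∑ i : Fin n, ∑ j ∈ Finset.univ.erase i,
        ∫⁻ X in cellN n ℓ, (‖sliceFluct ℓ j (sliceFluct ℓ i Ψ) X‖₊ : ℝ≥0∞) ^ 2 =
      ((n : ℝ≥0∞) - 1) * ∑ i : Fin n, ∫⁻ X in cellN n ℓ, (‖sliceFluct ℓ i Ψ X‖₊ : ℝ≥0∞) ^ 2 := by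
  have h := sum_weight_identity hℓ hΨ (m := fun _ => (1 : ℝ≥0∞)) measurable_const
  simp only [one_mul] at h
  exact h.symm

/-- The arithmetic of the second equality of Lemma 5.2. [cite: LiebSolovej2001, Lemma 5.2] -/
theorem n0n0_arith {nr S N0 NP PP QP PQ QQ : ℝ} (h1 : N0 + NP = nr * S)
    (h2 : PP + QP = (nr - 1) * N0) (h3 : PQ + QQ = (nr - 1) * NP) (h4 : QP = PQ) :
    PP = nr * (nr - 1) * S - (2 * nr - 1) * NP + (NP + QQ) := by
  have hPP : PP = (nr - 1) * N0 - QP := by linarith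
  have hPQ : PQ = (nr - 1) * NP - QQ := by linarith
  have hN0 : N0 = nr * S - NP := by linarith
  rw [hPP, h4, hPQ, hN0]
  ring

/-- **`⟨n̂₀(n̂₀-1)⟩ = n(n-1)‖Ψ‖² - (2n-1)⟨n̂₊⟩ + ⟨n̂₊²⟩`** [LiebSolovej2001, Lemma 5.2, second
equality: `n̂₀ = n - n̂₊`], in expectation for a continuous `n`-body function (`ℓ > 0`), with
`⟨n̂₀(n̂₀-1)⟩ = ∑_{i≠j}‖PᵢPⱼΨ‖²`, `⟨n̂₊⟩ = ∑ⱼ‖QⱼΨ‖²`, `⟨n̂₊²⟩ = ⟨n̂₊⟩ + ∑_{i≠j}‖QⱼQᵢΨ‖²`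
(all in `L²(Λⁿ)`, as real numbers). [cite: LiebSolovej2001, Lemma 5.2] -/
theorem n0n0_identity (hℓ : 0 < ℓ) {Ψ : Config n → ℂ} (hΨ : Continuous Ψ) :
    (∑ j : Fin n, ∑ i ∈ Finset.univ.erase j,
        ∫⁻ X in cellN n ℓ, (‖sliceMean ℓ i (sliceMean ℓ j Ψ) X‖₊ : ℝ≥0∞) ^ 2).toReal =
      n * ((n : ℝ) - 1) * (∫⁻ X in cellN n ℓ, (‖Ψ X‖₊ : ℝ≥0∞) ^ 2).toReal -
        (2 * n - 1) * (∑ i : Fin n, ∫⁻ X in cellN n ℓ, (‖sliceFluct ℓ i Ψ X‖₊ : ℝ≥0∞) ^ 2).toReal +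
        ((∑ i : Fin n, ∫⁻ X in cellN n ℓ, (‖sliceFluct ℓ i Ψ X‖₊ : ℝ≥0∞) ^ 2).toReal +
          (∑ i : Fin n, ∑ j ∈ Finset.univ.erase i,
            ∫⁻ X in cellN n ℓ, (‖sliceFluct ℓ j (sliceFluct ℓ i Ψ) X‖₊ : ℝ≥0∞) ^ 2).toReal) := by
  -- the objects and their finiteness
  set S : ℝ≥0∞ := ∫⁻ X in cellN n ℓ, (‖Ψ X‖₊ : ℝ≥0∞) ^ 2 with hS
  set N0 : ℝ≥0∞ := ∑ j : Fin n, ∫⁻ X in cellN n ℓ, (‖sliceMean ℓ j Ψ X‖₊ : ℝ≥0∞) ^ 2 with hN0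
  set NP : ℝ≥0∞ := ∑ i : Fin n, ∫⁻ X in cellN n ℓ, (‖sliceFluct ℓ i Ψ X‖₊ : ℝ≥0∞) ^ 2 with hNP
  set PP : ℝ≥0∞ := ∑ j : Fin n, ∑ i ∈ Finset.univ.erase j,
    ∫⁻ X in cellN n ℓ, (‖sliceMean ℓ i (sliceMean ℓ j Ψ) X‖₊ : ℝ≥0∞) ^ 2 with hPP
  set QP : ℝ≥0∞ := ∑ j : Fin n, ∑ i ∈ Finset.univ.erase j,
    ∫⁻ X in cellN n ℓ, (‖sliceFluct ℓ i (sliceMean ℓ j Ψ) X‖₊ : ℝ≥0∞) ^ 2 with hQP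
  set PQ : ℝ≥0∞ := ∑ i : Fin n, ∑ j ∈ Finset.univ.erase i,
    ∫⁻ X in cellN n ℓ, (‖sliceMean ℓ j (sliceFluct ℓ i Ψ) X‖₊ : ℝ≥0∞) ^ 2 with hPQ
  set QQ : ℝ≥0∞ := ∑ i : Fin n, ∑ j ∈ Finset.univ.erase i,
    ∫⁻ X in cellN n ℓ, (‖sliceFluct ℓ j (sliceFluct ℓ i Ψ) X‖₊ : ℝ≥0∞) ^ 2 with hQQ
  have hPc : ∀ j : Fin n, Continuous (sliceMean ℓ j Ψ) := fun j => continuous_sliceMean ℓ j hΨ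
  have hQc : ∀ i : Fin n, Continuous (sliceFluct ℓ i Ψ) := fun i => continuous_sliceFluct ℓ i hΨ
  have hStop : S ≠ ⊤ := (setLIntegral_cellN_normSq_lt_top hΨ ℓ).ne
  have hN0top : N0 ≠ ⊤ := ENNReal.sum_ne_top.2 fun j _ => (setLIntegral_cellN_normSq_lt_top (hPc j) ℓ).ne
  have hNPtop : NP ≠ ⊤ := ENNReal.sum_ne_top.2 fun i _ => (setLIntegral_cellN_normSq_lt_top (hQc i) ℓ).ne
  have hPPtop : PP ≠ ⊤ := ENNReal.sum_ne_top.2 fun j _ => ENNReal.sum_ne_top.2 fun i _ =>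
    (setLIntegral_cellN_normSq_lt_top (continuous_sliceMean ℓ i (hPc j)) ℓ).ne
  have hQPtop : QP ≠ ⊤ := ENNReal.sum_ne_top.2 fun j _ => ENNReal.sum_ne_top.2 fun i _ =>
    (setLIntegral_cellN_normSq_lt_top (continuous_sliceFluct ℓ i (hPc j)) ℓ).ne
  have hPQtop : PQ ≠ ⊤ := ENNReal.sum_ne_top.2 fun i _ => ENNReal.sum_ne_top.2 fun j _ =>
    (setLIntegral_cellN_normSq_lt_top (continuous_sliceMean ℓ j (hQc i)) ℓ).ne
  have hQQtop : QQ ≠ ⊤ := ENNReal.sum_ne_top.2 fun i _ => ENNReal.sum_ne_top.2 fun j _ =>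
    (setLIntegral_cellN_normSq_lt_top (continuous_sliceFluct ℓ j (hQc i)) ℓ).ne
  -- the four identities in `ℝ≥0∞`
  have e1 : N0 + NP = n * S := sum_normSq_P_add_sum_normSq_Q hℓ hΨ
  have e2 : PP + QP = ((n : ℝ≥0∞) - 1) * N0 := sum_PP_add_sum_QP hℓ hΨ
  have e3 : PQ + QQ = ((n : ℝ≥0∞) - 1) * NP := sum_PQ_add_sum_QQ hℓ hΨ
  have e4 : QP = PQ := by
    rw [hQP, hPQ, Finset.sum_comm' (t' := Finset.univ) (s' := fun i => Finset.univ.erase i)]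
    · refine Finset.sum_congr rfl fun i _ => Finset.sum_congr rfl fun j _ => ?_
      refine lintegral_congr fun X => ?_
      have hnn : ‖sliceFluct ℓ i (sliceMean ℓ j Ψ) X‖₊ = ‖sliceMean ℓ j (sliceFluct ℓ i Ψ) X‖₊ :=
        NNReal.eq (by simpa only [coe_nnnorm] using normSq_QP_eq_normSq_PQ hℓ i j hΨ X)
      rw [hnn]
    · intro j i
      simp only [Finset.mem_univ, Finset.mem_erase, ne_eq, and_true, true_and]
      exact ⟨fun h => Ne.symm h, fun h => Ne.symm h⟩
  -- pass to reals
  rcases Nat.eq_zero_or_pos n with hn | hn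
  · subst hn
    simp [hPP, hNP, hQQ]
  have hn1 : ((n : ℝ≥0∞) - 1).toReal = (n : ℝ) - 1 := by
    rw [ENNReal.toReal_sub_of_le (by exact_mod_cast hn) (ENNReal.natCast_ne_top n)]; simp
  have r1 : N0.toReal + NP.toReal = n * S.toReal := by
    have h := congrArg ENNReal.toReal e1
    rwa [ENNReal.toReal_add hN0top hNPtop, ENNReal.toReal_mul, ENNReal.toReal_natCast] at h
  have r2 : PP.toReal + QP.toReal = ((n : ℝ) - 1) * N0.toReal := by
    have h := congrArg ENNReal.toReal e2
    rwa [ENNReal.toReal_add hPPtop hQPtop, ENNReal.toReal_mul, hn1] at h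
  have r3 : PQ.toReal + QQ.toReal = ((n : ℝ) - 1) * NP.toReal := by
    have h := congrArg ENNReal.toReal e3
    rwa [ENNReal.toReal_add hPQtop hQQtop, ENNReal.toReal_mul, hn1] at h
  have r4 : QP.toReal = PQ.toReal := by rw [e4]
  exact n0n0_arith r1 r2 r3 r4

end Literature.MathematicalPhysics.QuantumManyBody.JelliumBoseGas
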